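import Literature.NumberTheory.NumberFields.KummerRankRadicalDvdCount
import Literature.NumberTheory.NumberFields.KummerPlusMinusRankKernel
import Literature.NumberTheory.NumberFields.KummerRankRootsOfUnity
import Literature.NumberTheory.NumberFields.ScholzKummerGenerator
import Mathlib.GroupTheory.FiniteAbelian.Duality
import HarnessLib

/-!
# Lang's Theorem 2.1 with ramification at `p` allowed — II: an abelian extension of exponent `p` of the real
# subfield `K⁺` of a CM field `K ∋ ζ_p`, unramified outside `p`, has degree `≤ p^{1+s} · #Cl(K)⁻[p]`
# (`s` = number of primes of `K` above `p`); the reflection step of Greenberg's Lemma 5.9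

Topic `NumberTheory/NumberFields`; namespace `Literature.NumberTheory.NumberFields`.  Theorem-only file (no
definition, no named fact, no `sorry`), unconditional.  Written by the prover seat `bsd-eis-lam-a` g20 (cell `bsd-eis`,
`--supports` stmt-BirchSwinnertonDyer-19035, stub `stub_publishedL59`).  Sequel of `KummerRankRadicalDvdCount.lean`
and of the tree's proof of Lang's Thm. 2.1 (i) (`KummerPlusMinusRankOne.lean`, whose §B–§E are followed line by line).

**Theorem** (`IsCMField.natCard_aut_le_of_isUnramifiedIn_outside`).  Let `K` be a CM number field containing a
primitive `p`-th root of unity (`p` an odd prime), `K⁺` its maximal real subfield, and `E/K⁺` a finite Galois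
extension with COMMUTATIVE group of exponent `p` which is unramified at every finite prime of `K⁺` not containing `p`.
Then `#Gal(E/K⁺) ≤ p ^ (1 + s) · #(Cl_K[p] ∩ ker N_{K/K⁺})`, `s = #{primes of 𝓞_K containing p}`.

Proof (Lang's, with one more layer).  Let `M = K E` (`QuadraticLift`), `G = Gal(M/K) ≅ Gal(E/K⁺)`, killed by `p`
and commutative; `M/K` is unramified at the primes not above `p` (Part I).  Every character `χ : G → K^×` has an
integral eigenvector `α_χ`, `α_χ^p = β_χ ∈ 𝓞_K ∖ 0` (`KummerEigenvector`), and `p ∣ v(β_χ)` for `v ∤ p`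
(`dvd_count_of_eq_pow_of_isUnramifiedIn`).  NEW LAYER: `λ(χ) = (v(β_χ) mod p)_{v ∣ p}`; eigenspaces being lines,
`v(β_{χ₁χ₂^{p−1}}) ≡ v(β_{χ₁}) − v(β_{χ₂}) (mod p)`, so the fibres of `λ` are translates of subsets of
`G₀ = {χ : p ∣ v(β_χ) for all v}` and `#Ĝ ≤ p^s · #G₀`.  For `χ ∈ G₀`, Part I gives `(β_χ) = 𝔟_χ^p` with
`[𝔟_χ] ∈ Cl_K[p] ∩ ker N`; the fibres of `χ ↦ [𝔟_χ]` on `G₀` are translates of subsets of the principal locus, which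
has `≤ p` elements (root-of-unity eigenvectors, `KummerRankRootsOfUnity`), so `#G₀ ≤ p · #(Cl_K[p] ∩ ker N)`.

This is the «Kummer/reflection bookkeeping» of Greenberg's proof of Lemma 5.9 (LNM 1716, pp. 143–144: the even
part of the unramified-outside-`p` Iwasawa module of a real abelian field against the odd part of the class group),
at ONE finite layer and in counting form; nothing about `ℤ_p`-extensions or elliptic curves is used here.

## References

* S. Lang, *Cyclotomic Fields I and II*, GTM 121 (1990), Ch. 13 §2, Thm. 2.1 (i) and its proof. [Lang1990]
* R. Greenberg, *Iwasawa theory for elliptic curves*, LNM 1716 (1999), §5 Lemma 5.9 (proof). [GreenbergLNM1716]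
* L. C. Washington, *Introduction to Cyclotomic Fields*, 2nd ed. (1997), §10.2 (reflection theorems). [Washington1997]
-/

noncomputable section

open NumberField NumberField.IsCMField IsDedekindDomain Module IntermediateField
open scoped nonZeroDivisors

namespace Literature.NumberTheory.NumberFields

section Plumbing

variable {F K : Type} [Field F] [Field K] [Algebra F K]

/-- A finite extension `E` of `F` (an abstract `F`-algebra which is a field) has an `F`-isomorphic copy inside `K̄`,
for every algebraic `K/F` (Mathlib `IsAlgClosed.lift`). [folklore] -/
private theorem exists_intermediateField_algEquiv_of_finiteDimensional [Algebra.IsAlgebraic F K]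
    (E : Type) [Field E] [Algebra F E] [FiniteDimensional F E] :
    ∃ E₁ : IntermediateField F (AlgebraicClosure K), Nonempty (E ≃ₐ[F] E₁) := by
  haveI : Algebra.IsAlgebraic F E := Algebra.IsAlgebraic.of_finite F E
  let f : E →ₐ[F] AlgebraicClosure K := IsAlgClosed.lift
  exact ⟨f.fieldRange, ⟨AlgEquiv.ofInjectiveField f⟩⟩

/-- Prime exponents of principal ideals related by `d^p β = n^p β'` agree modulo `p`. [folklore] -/
private theorem natCast_count_eq_of_pow_mul_eq {R : Type*} [CommRing R] [IsDedekindDomain R] {p : ℕ}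
    {d n β β' : R} (hd : d ≠ 0) (hn : n ≠ 0) (hβ : β ≠ 0) (hβ' : β' ≠ 0)
    (h : d ^ p * β = n ^ p * β') (v : HeightOneSpectrum R) :
    (((Associates.mk v.asIdeal).count (Associates.mk (Ideal.span {β})).factors : ℕ) : ZMod p) =
      (((Associates.mk v.asIdeal).count (Associates.mk (Ideal.span {β'})).factors : ℕ) : ZMod p) := by
  classical
  have hv : Irreducible (Associates.mk v.asIdeal) := Associates.irreducible_mk.mpr v.irreducible
  have hne : ∀ {x : R}, x ≠ 0 → Associates.mk (Ideal.span {x}) ≠ 0 := fun {x} hx => by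
    rw [Ne, Associates.mk_eq_zero, Submodule.zero_eq_bot, Ideal.span_singleton_eq_bot]
    exact hx
  have hI : Ideal.span {d} ^ p * Ideal.span {β} = Ideal.span {n} ^ p * Ideal.span {β'} := by
    rw [Ideal.span_singleton_pow, Ideal.span_singleton_pow, Ideal.span_singleton_mul_span_singleton,
      Ideal.span_singleton_mul_span_singleton, h]
  have hc : (Associates.mk v.asIdeal).count (Associates.mk (Ideal.span {d} ^ p * Ideal.span {β})).factors =
      (Associates.mk v.asIdeal).count (Associates.mk (Ideal.span {n} ^ p * Ideal.span {β'})).factors := by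
    rw [hI]
  rw [← Associates.mk_mul_mk, ← Associates.mk_mul_mk, Associates.mk_pow, Associates.mk_pow,
    Associates.count_mul (pow_ne_zero _ (hne hd)) (hne hβ) hv,
    Associates.count_mul (pow_ne_zero _ (hne hn)) (hne hβ') hv,
    Associates.count_pow (hne hd) hv, Associates.count_pow (hne hn) hv] at hc
  have hc' := congrArg (fun m : ℕ => (m : ZMod p)) hc
  simp only [Nat.cast_add, Nat.cast_mul, ZMod.natCast_self, zero_mul, zero_add] at hc'
  exact hc'

/-- Prime exponents of `(x y^(p-1))` modulo `p`: `v(x y^{p−1}) ≡ v(x) + (p−1) v(y)`. [folklore] -/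
private theorem natCast_count_mul_pow {R : Type*} [CommRing R] [IsDedekindDomain R] (p : ℕ)
    {x y : R} (hx : x ≠ 0) (hy : y ≠ 0) (v : HeightOneSpectrum R) :
    (((Associates.mk v.asIdeal).count (Associates.mk (Ideal.span {x * y ^ (p - 1)})).factors : ℕ) :
        ZMod p) =
      ((Associates.mk v.asIdeal).count (Associates.mk (Ideal.span {x})).factors : ℕ) +
        (p - 1 : ℕ) * ((Associates.mk v.asIdeal).count (Associates.mk (Ideal.span {y})).factors : ℕ) := by
  classical
  have hv : Irreducible (Associates.mk v.asIdeal) := Associates.irreducible_mk.mpr v.irreducible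
  have hne : ∀ {z : R}, z ≠ 0 → Associates.mk (Ideal.span {z}) ≠ 0 := fun {z} hz => by
    rw [Ne, Associates.mk_eq_zero, Submodule.zero_eq_bot, Ideal.span_singleton_eq_bot]
    exact hz
  rw [← Ideal.span_singleton_mul_span_singleton, ← Ideal.span_singleton_pow, ← Associates.mk_mul_mk,
    Associates.mk_pow, Associates.count_mul (hne hx) (pow_ne_zero _ (hne hy)) hv,
    Associates.count_pow (hne hy) hv]
  push_cast
  ring

end Plumbing

section Main

variable (K : Type) [Field K] [NumberField K] [IsCMField K]

set_option maxHeartbeats 400000 in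
/-- **Lang's Theorem 2.1 (i) with ramification above `p` allowed.**  For a CM number field `K` containing a
primitive `p`-th root of unity (`p` an odd prime) and a finite Galois extension `E` of its maximal real subfield
`K⁺` with commutative Galois group of exponent `p`, unramified at every finite prime of `K⁺` not containing `p`:
`#Gal(E/K⁺) ≤ p ^ (1 + s) · #(Cl_K[p] ∩ ker N_{K/K⁺})` with `s` the number of primes of `𝓞_K` containing `p`.
(The reflection step of Greenberg's Lemma 5.9: the `p`-rank of the maximal abelian exponent-`p` extension of a
totally real field unramified outside `p` is controlled by the class group of `K = K⁺(ζ_p)`.)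
[cite: Lang1990, Ch. 13 §2, Thm. 2.1 (i) (proof)] [cite: GreenbergLNM1716, §5 Lemma 5.9 (proof, pp. 143–144)] -/
theorem IsCMField.natCard_aut_le_of_isUnramifiedIn_outside {p : ℕ} (hp : p.Prime) (hp2 : p ≠ 2) {ζ : K}
    (hζ : IsPrimitiveRoot ζ p)
    (E : Type) [Field E] [NumberField E] [Algebra (maximalRealSubfield K) E]
    [FiniteDimensional (maximalRealSubfield K) E] [IsGalois (maximalRealSubfield K) E]
    [IsMulCommutative (E ≃ₐ[maximalRealSubfield K] E)]
    (hEexp : ∀ σ : E ≃ₐ[maximalRealSubfield K] E, σ ^ p = 1)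
    (hEunr : ∀ v : HeightOneSpectrum (𝓞 (maximalRealSubfield K)),
      ((p : ℕ) : 𝓞 (maximalRealSubfield K)) ∉ v.asIdeal → Algebra.IsUnramifiedIn (𝓞 E) v.asIdeal) :
    Nat.card (E ≃ₐ[maximalRealSubfield K] E) ≤
      p ^ (1 + Nat.card {v : HeightOneSpectrum (𝓞 K) // ((p : ℕ) : 𝓞 K) ∈ v.asIdeal}) *
        Nat.card ↥((powMonoidHom p : ClassGroup (𝓞 K) →* ClassGroup (𝓞 K)).ker ⊓
          (classGroupNorm (maximalRealSubfield K) K).ker) := by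
  classical
  haveI : Fact p.Prime := ⟨hp⟩
  have h2 : finrank (maximalRealSubfield K) K = 2 :=
    (IsCMField.isQuadraticExtension K).finrank_eq_two
  haveI : FiniteDimensional (maximalRealSubfield K) K := Module.finite_of_finrank_eq_succ h2
  -- the finite set of primes of `K` above `p`
  set Sp := {v : HeightOneSpectrum (𝓞 K) // ((p : ℕ) : 𝓞 K) ∈ v.asIdeal} with hSp
  haveI : Finite Sp := by
    have hp0 : (Ideal.span {((p : ℕ) : 𝓞 K)} : Ideal (𝓞 K)) ≠ ⊥ := by
      rw [Ne, Ideal.span_singleton_eq_bot]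
      exact_mod_cast hp.ne_zero
    refine ((Ideal.finite_factors hp0).subset ?_).to_subtype
    intro v hv
    exact (Ideal.dvd_span_singleton).mpr hv
  haveI : Fintype Sp := Fintype.ofFinite Sp
  set Ccard := Nat.card ↥((powMonoidHom p : ClassGroup (𝓞 K) →* ClassGroup (𝓞 K)).ker ⊓
      (classGroupNorm (maximalRealSubfield K) K).ker) with hCcard
  have hCpos : 0 < Ccard := Nat.card_pos
  /- §A. Transport `E` into `K̄`. -/
  obtain ⟨E₁, ⟨e⟩⟩ :=
    exists_intermediateField_algEquiv_of_finiteDimensional (F := maximalRealSubfield K) (K := K) E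
  haveI : FiniteDimensional (maximalRealSubfield K) E₁ :=
    LinearEquiv.finiteDimensional e.toLinearEquiv
  haveI : IsGalois (maximalRealSubfield K) E₁ := IsGalois.of_algEquiv e
  haveI : IsMulCommutative (E₁ ≃ₐ[maximalRealSubfield K] E₁) :=
    ⟨⟨fun a b => e.autCongr.symm.injective (by
      rw [map_mul, map_mul]; exact IsMulCommutative.is_comm.comm _ _)⟩⟩
  have hE₁exp : ∀ σ : E₁ ≃ₐ[maximalRealSubfield K] E₁, σ ^ p = 1 := fun σ =>
    e.autCongr.symm.injective (by rw [map_pow, map_one]; exact hEexp _)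
  have hE₁card : Nat.card (E₁ ≃ₐ[maximalRealSubfield K] E₁) = Nat.card (E ≃ₐ[maximalRealSubfield K] E) :=
    Nat.card_congr e.autCongr.symm.toEquiv
  haveI : NumberField E₁ := NumberField.of_module_finite (maximalRealSubfield K) E₁
  have hE₁unr : ∀ v : HeightOneSpectrum (𝓞 (maximalRealSubfield K)),
      ((p : ℕ) : 𝓞 (maximalRealSubfield K)) ∉ v.asIdeal → Algebra.IsUnramifiedIn (𝓞 E₁) v.asIdeal :=
    fun v hv => isUnramifiedIn_of_algEquiv_of_isUnramifiedIn (e.symm : E₁ ≃ₐ[maximalRealSubfield K] E)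
      v.ne_bot (hEunr v hv)
  obtain ⟨r, hr⟩ : ∃ r : ℕ, Nat.card (E₁ ≃ₐ[maximalRealSubfield K] E₁) = p ^ r :=
    IsPGroup.exists_card_eq (fun σ => ⟨1, by rw [pow_one]; exact hE₁exp σ⟩)
  have hpE : finrank (maximalRealSubfield K) E₁ = p ^ r := by
    rw [← IsGalois.card_aut_eq_finrank, hr]
  /- §B. The lift `M = K E₁`: Galois of degree `p^r` over `K`, unramified at the primes not above `p`. -/
  obtain ⟨M, hM⟩ :=
    QuadraticLift.exists_restrictScalars_eq (F := maximalRealSubfield K) (K := K) E₁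
  haveI : FiniteDimensional K M := QuadraticLift.finiteDimensional hM
  haveI : IsGalois K M := QuadraticLift.isGalois hM
  have hcop : Nat.Coprime (finrank (maximalRealSubfield K) K) (finrank (maximalRealSubfield K) E₁) := by
    rw [h2, hpE]
    exact Nat.Coprime.pow_right _ ((Nat.coprime_primes Nat.prime_two hp).mpr hp2.symm)
  have hdeg : finrank K M = p ^ r := (QuadraticLift.finrank_eq hM hcop).trans hpE
  have hMunr : ∀ v : HeightOneSpectrum (𝓞 K), ((p : ℕ) : 𝓞 K) ∉ v.asIdeal →
      Algebra.IsUnramifiedIn (𝓞 M) v.asIdeal :=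
    QuadraticLift.isUnramifiedIn_of_finrank_eq_prime_pow_of_notMem hM h2 hp hp2 hpE p hE₁unr
  haveI : NumberField M := NumberField.of_module_finite K M
  obtain ⟨g, hg⟩ := IsCMField.exists_algEquiv_algebraicClosure_lift_complexConj K
  /- §C. `G = Gal(M/K)`: killed by `p`, commutative, of order `p^r = #Gal(E/K⁺)`. -/
  obtain ⟨hGexp, hGcomm⟩ := KummerRank.gal_pow_eq_one_and_comm K hM hE₁exp
  have hGcard : Nat.card (M ≃ₐ[K] M) = Nat.card (E ≃ₐ[maximalRealSubfield K] E) := by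
    rw [IsGalois.card_aut_eq_finrank, hdeg, ← hr, hE₁card]
  have hbound_pos : 0 < p ^ (1 + Nat.card Sp) * Ccard := Nat.mul_pos (pow_pos hp.pos _) hCpos
  -- the trivial case
  by_cases htriv : Nat.card (M ≃ₐ[K] M) = 1
  · rw [← hGcard, htriv]
    exact hbound_pos
  haveI : Nontrivial (M ≃ₐ[K] M) := by
    rw [← Finite.one_lt_card_iff_nontrivial]
    have := Nat.card_pos (α := M ≃ₐ[K] M)
    omega
  letI instCG : CommGroup (M ≃ₐ[K] M) := { (inferInstance : Group (M ≃ₐ[K] M)) with mul_comm := hGcomm }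
  have hexp : Monoid.exponent (M ≃ₐ[K] M) = p := by
    rw [Monoid.exponent_eq_prime_iff hp]
    intro τ hτ
    have hd : orderOf τ ∣ p := orderOf_dvd_of_pow_eq_one (hGexp τ)
    rcases (Nat.dvd_prime hp).mp hd with h | h
    · exact absurd (orderOf_eq_one_iff.mp h) hτ
    · exact h
  haveI : HasEnoughRootsOfUnity K (Monoid.exponent (M ≃ₐ[K] M)) := by
    rw [hexp]
    exact ⟨⟨ζ, hζ⟩, inferInstance⟩
  have hchar : Nat.card ((M ≃ₐ[K] M) →* Kˣ) = Nat.card (M ≃ₐ[K] M) :=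
    CommGroup.card_monoidHom_of_hasEnoughRootsOfUnity (M ≃ₐ[K] M) K
  /- §D. Eigenvectors and radicals for every character. -/
  have hχp : ∀ (χ : (M ≃ₐ[K] M) →* Kˣ) (τ : M ≃ₐ[K] M), χ τ ^ p = 1 := fun χ τ => by
    rw [← map_pow, hGexp, map_one]
  have key : ∀ χ : (M ≃ₐ[K] M) →* Kˣ, ∃ (α : 𝓞 M) (β : 𝓞 K),
      (α : M) ≠ 0 ∧ (∀ τ : M ≃ₐ[K] M, τ (α : M) = ((χ τ : Kˣ) : K) • (α : M)) ∧
      algebraMap (𝓞 K) (𝓞 M) β = α ^ p ∧ β ≠ 0 := by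
    intro χ
    obtain ⟨α₀, hα₀0, hα₀⟩ := KummerEigenvector.exists_eigenvector χ
    have halg : IsAlgebraic ℤ α₀ :=
      (IsFractionRing.isAlgebraic_iff ℤ ℚ M).mpr (Algebra.IsAlgebraic.isAlgebraic α₀)
    obtain ⟨y, hy0, hyint⟩ := halg.exists_integral_multiple
    have hαeig : ∀ τ : M ≃ₐ[K] M, τ (y • α₀) = ((χ τ : Kˣ) : K) • (y • α₀) := fun τ => by
      rw [map_zsmul, hα₀ τ, smul_comm]
    have hα0 : (y • α₀ : M) ≠ 0 := smul_ne_zero hy0 hα₀0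
    obtain ⟨b, hb⟩ := KummerEigenvector.pow_mem_range hαeig (hχp χ)
    have hbint : IsIntegral ℤ b := by
      apply (isIntegral_algebraMap_iff (FaithfulSMul.algebraMap_injective K M)).mp
      rw [hb]
      exact hyint.pow p
    have hαβ : algebraMap (𝓞 K) (𝓞 M) ⟨b, hbint⟩ = (⟨y • α₀, hyint⟩ : 𝓞 M) ^ p := by
      apply Subtype.ext
      change algebraMap K M b = (y • α₀) ^ p
      exact hb
    have hbne : b ≠ 0 := by
      intro hb0
      rw [hb0, map_zero] at hb
      exact hα0 (pow_eq_zero_iff hp.ne_zero |>.mp hb.symm)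
    exact ⟨⟨y • α₀, hyint⟩, ⟨b, hbint⟩, hα0, hαeig, hαβ, RingOfIntegers.coe_ne_zero_iff.mp hbne⟩
  choose α β hα0 hαeig hαβ hβ0 using key
  have hαβM : ∀ χ : (M ≃ₐ[K] M) →* Kˣ, (α χ : M) ^ p = algebraMap K M ((β χ : 𝓞 K) : K) := by
    intro χ
    have h1 := congrArg (fun z : 𝓞 M => (z : M)) (hαβ χ)
    simp only [RingOfIntegers.coe_eq_algebraMap, map_pow] at h1
    rw [← IsScalarTower.algebraMap_apply (𝓞 K) (𝓞 M) M, IsScalarTower.algebraMap_apply (𝓞 K) K M] at h1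
    exact h1.symm
  -- the prime exponents of the radicals
  let cnt : ((M ≃ₐ[K] M) →* Kˣ) → HeightOneSpectrum (𝓞 K) → ℕ := fun χ v =>
    (Associates.mk v.asIdeal).count (Associates.mk (Ideal.span {β χ})).factors
  have hcnt_away : ∀ (χ : (M ≃ₐ[K] M) →* Kˣ) (v : HeightOneSpectrum (𝓞 K)),
      ((p : ℕ) : 𝓞 K) ∉ v.asIdeal → p ∣ cnt χ v := fun χ v hv =>
    dvd_count_of_eq_pow_of_isUnramifiedIn (hβ0 χ) (hαβ χ) v (hMunr v hv)
  -- eigen-products: `α χ₁ · (α χ₂)^(p-1)` is an eigenvector for `χ₁ χ₂^(p-1)`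
  have heigmul : ∀ (χ₁ χ₂ : (M ≃ₐ[K] M) →* Kˣ) (τ : M ≃ₐ[K] M),
      τ ((α χ₁ : M) * (α χ₂ : M) ^ (p - 1)) =
        (((χ₁ * χ₂ ^ (p - 1)) τ : Kˣ) : K) • ((α χ₁ : M) * (α χ₂ : M) ^ (p - 1)) := by
    intro χ₁ χ₂ τ
    rw [map_mul, map_pow, hαeig χ₁ τ, hαeig χ₂ τ, MonoidHom.mul_apply, MonoidHom.pow_apply,
      Units.val_mul, Units.val_pow_eq_pow_val, smul_pow, smul_mul_smul_comm]
  -- the exponents of `β (χ₁ χ₂^(p-1))` modulo `p`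
  have hcnt_mul : ∀ (χ₁ χ₂ : (M ≃ₐ[K] M) →* Kˣ) (v : HeightOneSpectrum (𝓞 K)),
      ((cnt (χ₁ * χ₂ ^ (p - 1)) v : ℕ) : ZMod p) =
        (cnt χ₁ v : ℕ) + (p - 1 : ℕ) * (cnt χ₂ v : ℕ) := by
    intro χ₁ χ₂ v
    set ψ := χ₁ * χ₂ ^ (p - 1) with hψ
    have hα'0 : (α χ₁ : M) * (α χ₂ : M) ^ (p - 1) ≠ 0 :=
      mul_ne_zero (hα0 χ₁) (pow_ne_zero _ (hα0 χ₂))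
    obtain ⟨k, hk⟩ := KummerEigenvector.div_mem_range (hαeig ψ) (heigmul χ₁ χ₂)
    obtain ⟨n, d, hd, hnd⟩ := IsFractionRing.div_surjective (A := 𝓞 K) k
    have hd0 : d ≠ 0 := nonZeroDivisors.ne_zero hd
    have hdK : (d : K) ≠ 0 := RingOfIntegers.coe_ne_zero_iff.mpr hd0
    -- `d α_ψ = n α'`
    have hrelM : algebraMap K M (d : K) * (α ψ : M) =
        algebraMap K M (n : K) * ((α χ₁ : M) * (α χ₂ : M) ^ (p - 1)) := by
      have h1 : (α ψ : M) = algebraMap K M k * ((α χ₁ : M) * (α χ₂ : M) ^ (p - 1)) := by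
        rw [hk, div_mul_cancel₀ _ hα'0]
      rw [h1, ← hnd, ← mul_assoc, ← map_mul]
      congr 1
      rw [mul_div_cancel₀ _ hdK]
    have hrel : algebraMap (𝓞 K) (𝓞 M) d * α ψ = algebraMap (𝓞 K) (𝓞 M) n * (α χ₁ * α χ₂ ^ (p - 1)) := by
      apply Subtype.ext
      change algebraMap K M (d : K) * (α ψ : M) = algebraMap K M (n : K) * ((α χ₁ : M) * (α χ₂ : M) ^ (p - 1))
      exact hrelM
    -- `d^p β_ψ = n^p β₁ β₂^(p-1)` in `𝓞 K`
    have hrelK : d ^ p * β ψ = n ^ p * (β χ₁ * β χ₂ ^ (p - 1)) := by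
      apply FaithfulSMul.algebraMap_injective (𝓞 K) (𝓞 M)
      rw [map_mul, map_mul, map_pow, map_pow, hαβ ψ, map_mul, map_pow, hαβ χ₁, hαβ χ₂, ← mul_pow,
        hrel, mul_pow, mul_pow, ← pow_mul, ← pow_mul, mul_comm (p - 1) p]
    have hβ'0 : β χ₁ * β χ₂ ^ (p - 1) ≠ 0 := mul_ne_zero (hβ0 χ₁) (pow_ne_zero _ (hβ0 χ₂))
    have hn0 : n ≠ 0 := by
      intro hn0
      rw [hn0, zero_pow hp.ne_zero, zero_mul, mul_eq_zero] at hrelK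
      rcases hrelK with h | h
      · exact hd0 (pow_eq_zero_iff hp.ne_zero |>.mp h)
      · exact hβ0 ψ h
    rw [natCast_count_eq_of_pow_mul_eq hd0 hn0 (hβ0 ψ) hβ'0 hrelK v]
    exact natCast_count_mul_pow p (hβ0 χ₁) (hβ0 χ₂) v
  -- `P0 χ`: every prime exponent of `β χ` is divisible by `p`
  let P0 : ((M ≃ₐ[K] M) →* Kˣ) → Prop := fun χ => ∀ v : HeightOneSpectrum (𝓞 K), p ∣ cnt χ v
  have hP0_of : ∀ χ₁ χ₂ : (M ≃ₐ[K] M) →* Kˣ,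
      (∀ v : Sp, ((cnt χ₁ v.1 : ℕ) : ZMod p) = (cnt χ₂ v.1 : ℕ)) → P0 (χ₁ * χ₂ ^ (p - 1)) := by
    intro χ₁ χ₂ h v
    by_cases hv : ((p : ℕ) : 𝓞 K) ∈ v.asIdeal
    · rw [← ZMod.natCast_eq_zero_iff, hcnt_mul, h ⟨v, hv⟩]
      have hp1 : ((p - 1 : ℕ) : ZMod p) = -1 := by
        rw [Nat.cast_sub hp.one_le, Nat.cast_one, ZMod.natCast_self, zero_sub]
      rw [hp1]
      ring
    · exact hcnt_away _ v hv
  haveI : Finite ((M ≃ₐ[K] M) →* Kˣ) :=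
    Nat.finite_of_card_ne_zero (by rw [hchar]; exact Nat.card_pos.ne')
  haveI : Fintype ((M ≃ₐ[K] M) →* Kˣ) := Fintype.ofFinite ((M ≃ₐ[K] M) →* Kˣ)
  let G0 : Finset ((M ≃ₐ[K] M) →* Kˣ) := Finset.univ.filter (fun χ => P0 χ)
  /- §D'. The layer above `p`: `#Ĝ ≤ p^s · #G₀` through `λ χ = (v(β_χ) mod p)_{v ∣ p}`. -/
  let lam : ((M ≃ₐ[K] M) →* Kˣ) → (Sp → ZMod p) := fun χ v => ((cnt χ v.1 : ℕ) : ZMod p)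
  have hlamfib : ∀ b ∈ Finset.univ.image lam,
      (Finset.univ.filter (fun χ : (M ≃ₐ[K] M) →* Kˣ => lam χ = b)).card ≤ G0.card := by
    intro b hb
    obtain ⟨χ₂, -, rfl⟩ := Finset.mem_image.mp hb
    refine Finset.card_le_card_of_injOn (fun χ => χ * χ₂ ^ (p - 1)) (fun χ hχ => ?_) ?_
    · have hχ : lam χ = lam χ₂ := (Finset.mem_filter.mp hχ).2
      refine Finset.mem_filter.mpr ⟨Finset.mem_univ _, hP0_of χ χ₂ fun v => ?_⟩
      exact congrFun hχ v
    · intro a _ b _ hab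
      exact mul_right_cancel hab
  have hlayer : (Finset.univ : Finset ((M ≃ₐ[K] M) →* Kˣ)).card ≤ G0.card * p ^ Nat.card Sp := by
    have h1 := Finset.card_le_mul_card_image (f := lam) Finset.univ G0.card hlamfib
    refine h1.trans (Nat.mul_le_mul_left _ ?_)
    calc (Finset.univ.image lam).card ≤ Fintype.card (Sp → ZMod p) := Finset.card_le_univ _
      _ = p ^ Nat.card Sp := by
          rw [Fintype.card_fun, ZMod.card, Nat.card_eq_fintype_card]
  /- §E. On `G₀`: the ideals `𝔟_χ` and the map `Φ : χ ↦ [𝔟_χ]`. -/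
  have key2 : ∀ χ : (M ≃ₐ[K] M) →* Kˣ, ∃ (𝔟 : Ideal (𝓞 K)) (c' : 𝓞 K) (h𝔟mem : 𝔟 ∈ (Ideal (𝓞 K))⁰),
      ClassGroup.mk0 ⟨𝔟, h𝔟mem⟩ ^ p = 1 ∧
      classGroupNorm (maximalRealSubfield K) K (ClassGroup.mk0 ⟨𝔟, h𝔟mem⟩) = 1 ∧
      (P0 χ → Ideal.span {β χ} = 𝔟 ^ p ∧ 𝔟 ≠ ⊥ ∧
        𝔟 * 𝔟.map (AmbiguousClass.intAut (complexConj K) : 𝓞 K →+* 𝓞 K) = Ideal.span {c'} ∧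
        c' ^ p = β χ * AmbiguousClass.intAut (complexConj K) (β χ)) := by
    intro χ
    by_cases hχ : P0 χ
    · obtain ⟨𝔟, c', h𝔟mem, h𝔟, h𝔟0, h𝔟𝔟, hkey, hN1, hxp⟩ :=
        KummerRank.exists_ideal_of_radical_of_dvd_count K hp hp2 hζ hM g hg (hβ0 χ) (hαβ χ) hχ
      exact ⟨𝔟, c', h𝔟mem, hxp, hN1, fun _ => ⟨h𝔟, h𝔟0, h𝔟𝔟, hkey⟩⟩
    · refine ⟨1, 1, one_mem _, ?_, ?_, fun h => (hχ h).elim⟩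
      · rw [show (⟨1, one_mem _⟩ : (Ideal (𝓞 K))⁰) = 1 from rfl, map_one, one_pow]
      · rw [show (⟨1, one_mem _⟩ : (Ideal (𝓞 K))⁰) = 1 from rfl, map_one, map_one]
  choose 𝔟 c' h𝔟mem hxp hN1 hrad using key2
  let Φ : ((M ≃ₐ[K] M) →* Kˣ) →
      ↥((powMonoidHom p : ClassGroup (𝓞 K) →* ClassGroup (𝓞 K)).ker ⊓
        (classGroupNorm (maximalRealSubfield K) K).ker) := fun χ =>
    ⟨ClassGroup.mk0 ⟨𝔟 χ, h𝔟mem χ⟩, Subgroup.mem_inf.mpr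
      ⟨by rw [MonoidHom.mem_ker, powMonoidHom_apply]; exact hxp χ, hN1 χ⟩⟩
  let S : Finset ((M ≃ₐ[K] M) →* Kˣ) := G0.filter (fun χ => ClassGroup.mk0 ⟨𝔟 χ, h𝔟mem χ⟩ = 1)
  -- eigen-characters are determined by their eigenvector
  have huniq : ∀ (χ ψ : (M ≃ₐ[K] M) →* Kˣ) (ω : M), ω ≠ 0 →
      (∀ τ : M ≃ₐ[K] M, τ ω = ((χ τ : Kˣ) : K) • ω) →
      (∀ τ : M ≃ₐ[K] M, τ ω = ((ψ τ : Kˣ) : K) • ω) → χ = ψ := by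
    intro χ ψ ω hω0 h1 h2
    refine MonoidHom.ext fun τ => Units.ext ?_
    have h := (h1 τ).symm.trans (h2 τ)
    rw [Algebra.smul_def, Algebra.smul_def, mul_eq_mul_right_iff] at h
    rcases h with h | h
    · exact (FaithfulSMul.algebraMap_injective K M) h
    · exact absurd h hω0
  -- `#S ≤ p`: all of `S` consists of powers of one character
  have hS : S.card ≤ p := by
    by_cases htriv' : ∀ χ ∈ S, χ = 1
    · calc S.card ≤ ({1} : Finset ((M ≃ₐ[K] M) →* Kˣ)).card :=
            Finset.card_le_card (fun χ hχ => Finset.mem_singleton.mpr (htriv' χ hχ))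
        _ = 1 := Finset.card_singleton _
        _ ≤ p := hp.one_le
    simp only [not_forall, exists_prop] at htriv'
    obtain ⟨χ₀, hχ₀S, hχ₀1⟩ := htriv'
    have hχ₀G0 : P0 χ₀ := (Finset.mem_filter.mp (Finset.mem_filter.mp hχ₀S).1).2
    have hχ₀P : ClassGroup.mk0 ⟨𝔟 χ₀, h𝔟mem χ₀⟩ = 1 := (Finset.mem_filter.mp hχ₀S).2
    obtain ⟨h𝔟₀, h𝔟₀0, h𝔟𝔟₀, hkey₀⟩ := hrad χ₀ hχ₀G0
    haveI : (𝔟 χ₀ : Submodule (𝓞 K) (𝓞 K)).IsPrincipal :=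
      (ClassGroup.mk0_eq_one_iff (h𝔟mem χ₀)).mp hχ₀P
    obtain ⟨ω₀, hω₀0, hω₀fin, hω₀eig, hω₀p⟩ :=
      KummerRank.exists_isOfFinOrder_eigenvector_of_isPrincipal K hp hp2 (hα0 χ₀) (hαeig χ₀)
        (hαβM χ₀) h𝔟₀ h𝔟₀0 h𝔟𝔟₀ hkey₀
    have hω₀K : ω₀ ∉ Set.range (algebraMap K M) := fun hK =>
      hχ₀1 (KummerEigenvector.eq_one_of_mem_range hω₀eig hω₀0 hK)
    have hSsub : S ⊆ (Finset.range p).image (fun j => χ₀ ^ j) := by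
      intro χ hχS
      have hχG0 : P0 χ := (Finset.mem_filter.mp (Finset.mem_filter.mp hχS).1).2
      have hχP : ClassGroup.mk0 ⟨𝔟 χ, h𝔟mem χ⟩ = 1 := (Finset.mem_filter.mp hχS).2
      obtain ⟨h𝔟χ, h𝔟χ0, h𝔟𝔟χ, hkeyχ⟩ := hrad χ hχG0
      haveI : (𝔟 χ : Submodule (𝓞 K) (𝓞 K)).IsPrincipal :=
        (ClassGroup.mk0_eq_one_iff (h𝔟mem χ)).mp hχP
      obtain ⟨ω, hω0, hωfin, hωeig, hωp⟩ :=
        KummerRank.exists_isOfFinOrder_eigenvector_of_isPrincipal K hp hp2 (hα0 χ) (hαeig χ)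
          (hαβM χ) h𝔟χ h𝔟χ0 h𝔟𝔟χ hkeyχ
      obtain ⟨j, c, hj, hωc⟩ :=
        KummerRank.exists_eq_algebraMap_mul_pow hp hω₀fin hωfin hω₀p hωp hω₀K
      refine Finset.mem_image.mpr ⟨j, Finset.mem_range.mpr hj, ?_⟩
      have hc0 : c ≠ 0 := by
        rintro rfl
        rw [map_zero, zero_mul] at hωc
        exact hω0 hωc
      refine (huniq (χ₀ ^ j) χ ω hω0 (fun τ => ?_) hωeig)
      rw [hωc, map_mul, AlgEquiv.commutes, map_pow, hω₀eig τ, smul_pow, MonoidHom.pow_apply,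
        Units.val_pow_eq_pow_val, mul_smul_comm]
    calc S.card ≤ ((Finset.range p).image (fun j => χ₀ ^ j)).card := Finset.card_le_card hSsub
      _ ≤ (Finset.range p).card := Finset.card_image_le
      _ = p := Finset.card_range p
  -- fibres of `Φ` on `G₀` are translates of subsets of `S`
  have hfib : ∀ χ₁ ∈ G0, ∀ χ₂ ∈ G0, Φ χ₁ = Φ χ₂ → χ₁ * χ₂ ^ (p - 1) ∈ S := by
    intro χ₁ hχ₁ χ₂ hχ₂ h12
    have hP1 : P0 χ₁ := (Finset.mem_filter.mp hχ₁).2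
    have hP2 : P0 χ₂ := (Finset.mem_filter.mp hχ₂).2
    have hP12 : P0 (χ₁ * χ₂ ^ (p - 1)) := by
      refine hP0_of χ₁ χ₂ fun v => ?_
      rw [(ZMod.natCast_eq_zero_iff _ _).mpr (hP1 v.1), (ZMod.natCast_eq_zero_iff _ _).mpr (hP2 v.1)]
    obtain ⟨h𝔟₁, -, -, -⟩ := hrad χ₁ hP1
    obtain ⟨h𝔟₂, -, -, -⟩ := hrad χ₂ hP2
    obtain ⟨h𝔟₁₂, -, -, -⟩ := hrad (χ₁ * χ₂ ^ (p - 1)) hP12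
    have hx : ClassGroup.mk0 ⟨𝔟 χ₁, h𝔟mem χ₁⟩ = ClassGroup.mk0 ⟨𝔟 χ₂, h𝔟mem χ₂⟩ :=
      congrArg Subtype.val h12
    have hmem12 : 𝔟 χ₁ * 𝔟 χ₂ ^ (p - 1) ∈ (Ideal (𝓞 K))⁰ :=
      mul_mem (h𝔟mem χ₁) (pow_mem (h𝔟mem χ₂) _)
    have hW := KummerRank.mk0_eq_of_eigenvector K hp (h𝔟mem (χ₁ * χ₂ ^ (p - 1))) hmem12
      (hαeig (χ₁ * χ₂ ^ (p - 1))) (α' := α χ₁ * α χ₂ ^ (p - 1))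
      (fun τ => by
        push_cast
        exact heigmul χ₁ χ₂ τ)
      (by
        push_cast
        exact mul_ne_zero (hα0 χ₁) (pow_ne_zero _ (hα0 χ₂)))
      (hβ0 (χ₁ * χ₂ ^ (p - 1))) (hαβ (χ₁ * χ₂ ^ (p - 1))) (β' := β χ₁ * β χ₂ ^ (p - 1))
      (by rw [map_mul, map_pow, hαβ χ₁, hαβ χ₂, mul_pow, ← pow_mul, ← pow_mul, mul_comm (p - 1) p])
      h𝔟₁₂ (𝔟' := 𝔟 χ₁ * 𝔟 χ₂ ^ (p - 1))
      (by
        rw [← Ideal.span_singleton_mul_span_singleton, ← Ideal.span_singleton_pow, h𝔟₁, h𝔟₂,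
          mul_pow, ← pow_mul, ← pow_mul, mul_comm (p - 1) p])
    refine Finset.mem_filter.mpr ⟨Finset.mem_filter.mpr ⟨Finset.mem_univ _, hP12⟩, ?_⟩
    rw [← hW, show (⟨𝔟 χ₁ * 𝔟 χ₂ ^ (p - 1), hmem12⟩ : (Ideal (𝓞 K))⁰) =
      ⟨𝔟 χ₁, h𝔟mem χ₁⟩ * ⟨𝔟 χ₂, h𝔟mem χ₂⟩ ^ (p - 1) from rfl, map_mul, map_pow, hx,
      ← pow_succ', Nat.sub_add_cancel hp.one_le, hxp χ₂]
  have hfibcard : ∀ b ∈ G0.image Φ,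
      (G0.filter (fun χ : (M ≃ₐ[K] M) →* Kˣ => Φ χ = b)).card ≤ p := by
    intro b hb
    obtain ⟨χ₂, hχ₂, rfl⟩ := Finset.mem_image.mp hb
    refine le_trans ?_ hS
    refine Finset.card_le_card_of_injOn (fun χ => χ * χ₂ ^ (p - 1)) (fun χ hχ => ?_) ?_
    · have hχ' := Finset.mem_filter.mp hχ
      exact hfib χ hχ'.1 χ₂ hχ₂ hχ'.2
    · intro a _ b _ hab
      exact mul_right_cancel hab
  have hG0 : G0.card ≤ p * Ccard := by
    have hcount := Finset.card_le_mul_card_image (f := Φ) G0 p hfibcard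
    refine hcount.trans (Nat.mul_le_mul_left p ?_)
    haveI : Fintype ↥((powMonoidHom p : ClassGroup (𝓞 K) →* ClassGroup (𝓞 K)).ker ⊓
        (classGroupNorm (maximalRealSubfield K) K).ker) := Fintype.ofFinite _
    rw [hCcard, Nat.card_eq_fintype_card]
    exact Finset.card_le_univ _
  /- §F. Count. -/
  calc Nat.card (E ≃ₐ[maximalRealSubfield K] E)
      = Nat.card (M ≃ₐ[K] M) := hGcard.symm
    _ = Nat.card ((M ≃ₐ[K] M) →* Kˣ) := hchar.symm
    _ = (Finset.univ : Finset ((M ≃ₐ[K] M) →* Kˣ)).card := by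
        rw [Nat.card_eq_fintype_card, Finset.card_univ]
    _ ≤ G0.card * p ^ Nat.card Sp := hlayer
    _ ≤ (p * Ccard) * p ^ Nat.card Sp := Nat.mul_le_mul_right _ hG0
    _ = p ^ (1 + Nat.card Sp) * Ccard := by ring

end Main

end Literature.NumberTheory.NumberFields

end
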